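import Summits.MatrixMultiplication.OmegaCensus.EisClassCheck

/-!
# ω-census, family (b3): conjecture C9 — the Eisenstein groups `𝔽_p[ω] ⋊ C₃`: independence from a passed class check, and the two counts

HONEST FRAMING (pub-omega census; verbatim): lottery ticket; floor = certified bounds/negative ranges.
Census BOOKKEEPING (conjecture C9 of the cell; pub-omega stpp-1 gen 21).  Vocabulary: `EisClassCheck.lean`.
**`exists_indep_of_classOKE`**: a passed class check for `r = p mod 8` (`p ≥ 7` prime) gives a nondegenerate dihedral-type box of
`𝔽_p[ω] ⋊ ℤ/3` whose 2-D arc set `ClassDataE.arcs` (`blockArcSet` with the class trims) is an independent pattern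
(`patIndep_blockCells`: `Φ ≡ −p̄·E (mod 8)` by `map_lin`, `PairOK` from `OKc` in the real or imaginary coordinate); hence
`¬ BoxUseful (EisCyc p)` as soon as `9p² ≤ 5·#arcs` — either by the EXACT count `card_blockArcSet`
(**`not_boxUseful_of_classOKE_count`**, the inequality is decidable for a numeric `p`) or by the UNIFORM bound
`576 p² ≤ 5 (p − 7)(MIS·(p − 7) − Σt)` from `8·len ≥ p − 7 − lo − hi` (**`not_boxUseful_of_classOKE`**, `p ≥ 40`).
Tables and the assembled theorems: `EisClassTable.lean`.  Nothing here is progress on `ω`.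
-/

namespace Summit.MatrixMultiplication.OmegaCensus

open Finset

namespace EisArcs

open PhaseArcs (lin col map_lin)

variable {p : ℕ}

/-- The trims of a class datum as integer functions (the arguments of `blockArcSet`). [folklore] -/
def ClassDataE.Lo₁ (cd : ClassDataE) : Fin 3 × Fin 3 → ℤ × ℤ → ℤ := fun c φ => (cd.lo₁ c φ : ℤ)
/-- See `ClassDataE.Lo₁`. [folklore] -/
def ClassDataE.Hi₁ (cd : ClassDataE) : Fin 3 × Fin 3 → ℤ × ℤ → ℤ := fun c φ => (cd.hi₁ c φ : ℤ)
/-- See `ClassDataE.Lo₁`. [folklore] -/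
def ClassDataE.Lo₂ (cd : ClassDataE) : Fin 3 × Fin 3 → ℤ × ℤ → ℤ := fun c φ => (cd.lo₂ c φ : ℤ)
/-- See `ClassDataE.Lo₁`. [folklore] -/
def ClassDataE.Hi₂ (cd : ClassDataE) : Fin 3 × Fin 3 → ℤ × ℤ → ℤ := fun c φ => (cd.hi₂ c φ : ℤ)

/-- The arc set of a class datum at the prime `p`. [folklore] -/
noncomputable def ClassDataE.arcs (cd : ClassDataE) (p : ℕ) [NeZero p] : Finset ((Fin 3 × Fin 3) × Eis p) :=
  blockArcSet p cd.P cd.Lo₁ cd.Hi₁ cd.Lo₂ cd.Hi₂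

/-- **Independence (Eisenstein family).** A passed class check for `r = p mod 8` (`p ≥ 7` prime) gives a nondegenerate
dihedral-type box of `𝔽_p[ω] ⋊ ℤ/3` for which the 2-D arc set of the class datum is an independent pattern. [folklore] -/
theorem exists_indep_of_classOKE [Fact p.Prime] (hp : 7 ≤ p) (cd : ClassDataE) (r : ZMod 8) (hr : (p : ZMod 8) = r)
    (hok : cd.ClassOKE r) :
    haveI : NeZero p := ⟨(Fact.out : p.Prime).ne_zero⟩
    ∃ D : RCyc.RBox (Eis p) 3, D.Nondeg Eis.w ∧ D.PatIndep Eis.w (cd.arcs p) := by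
  have hprime : p.Prime := Fact.out
  haveI : NeZero p := ⟨hprime.ne_zero⟩
  obtain ⟨m, n, t, P, lo₁, hi₁, lo₂, hi₂⟩ := cd
  obtain ⟨hmn, hm3, hn3, ht, hP, hE, hpair⟩ := hok
  dsimp only at hmn hm3 hn3 ht hP hE hpair
  simp only [ClassDataE.arcs]
  have hpodd : Odd (p : ℤ) := by
    have h2 : ¬ 2 ∣ p := fun h => by
      have := hprime.eq_one_or_self_of_dvd 2 h
      omega
    rcases Nat.even_or_odd p with h | h
    · exact absurd h.two_dvd h2
    · exact_mod_cast h
  have h8 : (8 : ZMod p) ≠ 0 := by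
    intro h
    have h' : ((8 : ℕ) : ZMod p) = 0 := by exact_mod_cast h
    rw [ZMod.natCast_eq_zero_iff] at h'
    have h2 : p ∣ 2 := hprime.dvd_of_dvd_pow (show p ∣ 2 ^ 3 by simpa using h')
    have := Nat.le_of_dvd two_pos h2
    omega
  -- the box
  set ι : ZMod p := (8 : ZMod p)⁻¹ with hι
  set α : Eis p := ⟨ι, 0⟩ with hαdef
  set β : Eis p := ⟨(m : ZMod p) * ι, (n : ZMod p) * ι⟩ with hβdef
  set D : RCyc.RBox (Eis p) 3 := ⟨![0, α, 0], ![0, 0, 1], ![0, β, 0], ![0, 0, t]⟩ with hD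
  -- coordinates of the products
  have hprodα : ∀ s, RCyc.act Eis.w s * α = ⟨(gαR s : ZMod p) * ι, (gαI s : ZMod p) * ι⟩ := by
    intro s; rw [act_w_mul]; ext <;> simp [hαdef]
  have hprodβ : ∀ s, RCyc.act Eis.w s * β = ⟨(gβR m n s : ZMod p) * ι, (gβI m n s : ZMod p) * ι⟩ := by
    intro s
    rw [act_w_mul]
    rcases zmod3_cases s with rfl | rfl | rfl <;> (ext <;> (simp [hβdef, gαR, gαI, gβR, gβI]; try ring))
  -- phases (as functions) and their defining equations
  choose aαR haαR using fun s => eight_val_div h8 (gαR s)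
  choose aαI haαI using fun s => eight_val_div h8 (gαI s)
  choose aβR haβR using fun s => eight_val_div h8 (gβR m n s)
  choose aβI haβI using fun s => eight_val_div h8 (gβI m n s)
  have hαR : ∀ s i, 8 * ((RCyc.act Eis.w s * D.α i).re.val : ℤ) = col aαR s i * p + col gαR s i := by
    intro s i
    fin_cases i
    · simp [hD, col]
    · simpa [hD, col, hprodα s] using haαR s
    · simp [hD, col]
  have hαI : ∀ s i, 8 * ((RCyc.act Eis.w s * D.α i).im.val : ℤ) = col aαI s i * p + col gαI s i := by
    intro s i
    fin_cases i
    · simp [hD, col]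
    · simpa [hD, col, hprodα s] using haαI s
    · simp [hD, col]
  have hβR : ∀ s j, 8 * ((RCyc.act Eis.w s * D.β j).re.val : ℤ) = col aβR s j * p + col (gβR m n) s j := by
    intro s j
    fin_cases j
    · simp [hD, col]
    · simpa [hD, col, hprodβ s] using haβR s
    · simp [hD, col]
  have hβI : ∀ s j, 8 * ((RCyc.act Eis.w s * D.β j).im.val : ℤ) = col aβI s j * p + col (gβI m n) s j := by
    intro s j
    fin_cases j
    · simp [hD, col]
    · simpa [hD, col, hprodβ s] using haβI s
    · simp [hD, col]
  -- `PhiR` of the box is `lin`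
  have hPhi : ∀ (a b : ZMod 3 → ℤ) (c c' : Fin 3 × Fin 3), PhiR D (col a) (col b) c c' = lin t a b c c' := by
    intro a b c c'; rfl
  -- residues of the phases
  have resαR : ∀ s, ((aαR s : ℤ) : ZMod 8) = -(((p : ℤ) : ZMod 8) * (gαR s : ZMod 8)) := fun s =>
    phase_residue hpodd (haαR s)
  have resαI : ∀ s, ((aαI s : ℤ) : ZMod 8) = -(((p : ℤ) : ZMod 8) * (gαI s : ZMod 8)) := fun s =>
    phase_residue hpodd (haαI s)
  have resβR : ∀ s, ((aβR s : ℤ) : ZMod 8) = -(((p : ℤ) : ZMod 8) * (gβR m n s : ZMod 8)) := fun s =>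
    phase_residue hpodd (haβR s)
  have resβI : ∀ s, ((aβI s : ℤ) : ZMod 8) = -(((p : ℤ) : ZMod 8) * (gβI m n s : ZMod 8)) := fun s =>
    phase_residue hpodd (haβI s)
  -- `Φ ≡ −p̄·E (mod 8)` in each coordinate
  have hmodR : ∀ c c', ((lin t aαR aβR c c' : ℤ) : ZMod 8) = -((p : ZMod 8) * ((lin t gαR (gβR m n) c c' : ℤ) : ZMod 8)) := by
    intro c c'
    have h1 : ((lin t aαR aβR c c' : ℤ) : ZMod 8) = lin t (fun s => ((aαR s : ℤ) : ZMod 8)) (fun s => ((aβR s : ℤ) : ZMod 8)) c c' :=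
      map_lin (Int.castAddHom (ZMod 8)) t aαR aβR c c'
    have h2 : (((lin t gαR (gβR m n) c c' : ℤ) : ZMod 8)) =
        lin t (fun s => ((gαR s : ℤ) : ZMod 8)) (fun s => ((gβR m n s : ℤ) : ZMod 8)) c c' :=
      map_lin (Int.castAddHom (ZMod 8)) t gαR (gβR m n) c c'
    have h3 := map_lin (AddMonoidHom.mulLeft (-(p : ZMod 8))) t (fun s => ((gαR s : ℤ) : ZMod 8))
      (fun s => ((gβR m n s : ℤ) : ZMod 8)) c c'
    rw [h1, h2]
    simp only [AddMonoidHom.coe_mulLeft, neg_mul] at h3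
    rw [h3]
    congr 1 <;> funext s
    · simp only [Function.comp_apply, resαR]; push_cast; ring
    · simp only [Function.comp_apply, resβR]; push_cast; ring
  have hmodI : ∀ c c', ((lin t aαI aβI c c' : ℤ) : ZMod 8) = -((p : ZMod 8) * ((lin t gαI (gβI m n) c c' : ℤ) : ZMod 8)) := by
    intro c c'
    have h1 : ((lin t aαI aβI c c' : ℤ) : ZMod 8) = lin t (fun s => ((aαI s : ℤ) : ZMod 8)) (fun s => ((aβI s : ℤ) : ZMod 8)) c c' :=
      map_lin (Int.castAddHom (ZMod 8)) t aαI aβI c c'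
    have h2 : (((lin t gαI (gβI m n) c c' : ℤ) : ZMod 8)) =
        lin t (fun s => ((gαI s : ℤ) : ZMod 8)) (fun s => ((gβI m n s : ℤ) : ZMod 8)) c c' :=
      map_lin (Int.castAddHom (ZMod 8)) t gαI (gβI m n) c c'
    have h3 := map_lin (AddMonoidHom.mulLeft (-(p : ZMod 8))) t (fun s => ((gαI s : ℤ) : ZMod 8))
      (fun s => ((gβI m n s : ℤ) : ZMod 8)) c c'
    rw [h1, h2]
    simp only [AddMonoidHom.coe_mulLeft, neg_mul] at h3
    rw [h3]
    congr 1 <;> funext s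
    · simp only [Function.comp_apply, resαI]; push_cast; ring
    · simp only [Function.comp_apply, resβI]; push_cast; ring
  -- from `OKc` to `PairOK`
  have okc : ∀ {Φ E φ φ' : ℤ} {lo hi lo' hi' : ℕ} (Φv : ZMod 8), ((Φ : ℤ) : ZMod 8) = Φv → |E| ≤ 3 →
      ClassDataE.OKc (Φv.val : ℤ) E φ φ' lo hi lo' hi' →
      PhaseArcs.PairOK p Φ E φ φ' (lo : ℤ) (hi : ℤ) (lo' : ℤ) (hi' : ℤ) := by
    intro Φ E φ φ' lo hi lo' hi' Φv hΦ hE12 hok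
    obtain ⟨h0, hplus, hminus⟩ := hok
    have hΦmod : Φ % 8 = (Φv.val : ℤ) := by rw [← hΦ, ZMod.val_intCast]; rfl
    have hq : Φ % 8 + 8 * (Φ / 8) = Φ := Int.emod_add_mul_ediv Φ 8
    refine ⟨?_, ?_, ?_, ?_⟩
    · have : (7 : ℤ) ≤ p := by exact_mod_cast hp
      linarith
    · intro h; apply h0; omega
    · intro h hEpos
      have h' : (φ - φ' - (Φv.val : ℤ) - 1) % 8 = 0 := by omega
      rcases hplus h' hEpos with h1 | h1
      · left; exact_mod_cast h1
      · right; exact_mod_cast h1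
    · intro h hEneg
      have h' : (φ - φ' - (Φv.val : ℤ) + 1) % 8 = 0 := by omega
      rcases hminus h' hEneg with h1 | h1
      · left; exact_mod_cast h1
      · right; exact_mod_cast h1
  -- trims as integer functions
  set Lo₁ : Fin 3 × Fin 3 → ℤ × ℤ → ℤ := fun c φ => (lo₁ c φ : ℤ) with hLo₁
  set Hi₁ : Fin 3 × Fin 3 → ℤ × ℤ → ℤ := fun c φ => (hi₁ c φ : ℤ) with hHi₁
  set Lo₂ : Fin 3 × Fin 3 → ℤ × ℤ → ℤ := fun c φ => (lo₂ c φ : ℤ) with hLo₂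
  set Hi₂ : Fin 3 × Fin 3 → ℤ × ℤ → ℤ := fun c φ => (hi₂ c φ : ℤ) with hHi₂
  have hl₁ : ∀ c, ∀ φ ∈ P c, 0 ≤ Lo₁ c φ := fun c φ _ => Nat.cast_nonneg _
  have hh₁ : ∀ c, ∀ φ ∈ P c, 0 ≤ Hi₁ c φ := fun c φ _ => Nat.cast_nonneg _
  have hl₂ : ∀ c, ∀ φ ∈ P c, 0 ≤ Lo₂ c φ := fun c φ _ => Nat.cast_nonneg _
  have hh₂ : ∀ c, ∀ φ ∈ P c, 0 ≤ Hi₂ c φ := fun c φ _ => Nat.cast_nonneg _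
  have hP' : ∀ c, ∀ φ ∈ P c, (0 ≤ φ.1 ∧ φ.1 < 8) ∧ (0 ≤ φ.2 ∧ φ.2 < 8) := fun c φ hφ => (hP c φ hφ).1
  -- the pair condition
  have hcond : ∀ c c', c ≠ c' → ∀ φ ∈ P c, ∀ φ' ∈ P c',
      PhaseArcs.PairOK p (PhiR D (col aαR) (col aβR) c c') (PhiR D (col gαR) (col (gβR m n)) c c') φ.1 φ'.1
          (Lo₁ c φ) (Hi₁ c φ) (Lo₁ c' φ') (Hi₁ c' φ') ∨
        PhaseArcs.PairOK p (PhiR D (col aαI) (col aβI) c c') (PhiR D (col gαI) (col (gβI m n)) c c') φ.2 φ'.2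
          (Lo₂ c φ) (Hi₂ c φ) (Lo₂ c' φ') (Hi₂ c' φ') := by
    intro c c' hcc φ hφ φ' hφ'
    rw [hPhi, hPhi, hPhi, hPhi]
    obtain ⟨hER, hEI⟩ := hE c c' hcc
    rcases hpair c c' hcc φ hφ φ' hφ' with hok | hok
    · left
      exact okc _ (hr ▸ hmodR c c') hER hok
    · right
      exact okc _ (hr ▸ hmodI c c') hEI hok
  -- independence of the arc set
  have indep : D.PatIndep Eis.w (blockArcSet p P Lo₁ Hi₁ Lo₂ Hi₂) :=
    (patIndep_blockCells D (col aαR) (col gαR) (col aβR) (col (gβR m n)) (col aαI) (col gαI) (col aβI)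
      (col (gβI m n)) hαR hβR hαI hβI P Lo₁ Hi₁ Lo₂ Hi₂ hl₁ hh₁ hl₂ hh₂ hcond).anti
      (blockArcSet_subset hP' hl₁ hh₁ hl₂ hh₂)
  -- nondegeneracy
  have hι0 : ι ≠ 0 := inv_ne_zero h8
  have hα0 : α ≠ 0 := by
    intro h
    have := congrArg QuadraticAlgebra.re h
    simp [hαdef] at this
    exact hι0 this
  have hβ0 : β ≠ 0 := by
    intro h
    have hre := congrArg QuadraticAlgebra.re h
    have him := congrArg QuadraticAlgebra.im h
    simp only [hβdef, QuadraticAlgebra.re_zero, QuadraticAlgebra.im_zero, mul_eq_zero, hι0, or_false] at hre him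
    have hsmall : ∀ k : ℤ, |k| ≤ 3 → ((k : ZMod p) = 0) → k = 0 := by
      intro k hk h0
      rw [ZMod.intCast_zmod_eq_zero_iff_dvd] at h0
      rcases eq_or_ne k 0 with h | h
      · exact h
      · exfalso
        have := Int.le_of_dvd (abs_pos.2 h) ((dvd_abs _ _).2 h0)
        omega
    rcases hmn with h | h
    · exact h (hsmall m hm3 hre)
    · exact h (hsmall n hn3 him)
  have hD' : D.Nondeg Eis.w := by
    refine D.nondeg_of Eis.w ?_ ?_
    · intro i i' h
      simp only [hD, Prod.mk.injEq] at h
      obtain ⟨h1, h2⟩ := h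
      fin_cases i <;> fin_cases i' <;> simp (decide := true) [hα0, hα0.symm] at h1 h2 ⊢
    · intro j j' h
      simp only [hD, Prod.mk.injEq] at h
      obtain ⟨h1, h2⟩ := h
      fin_cases j <;> fin_cases j' <;> simp (decide := true) [hβ0, hβ0.symm, ht, ht.symm] at h1 h2 ⊢
  exact ⟨D, hD', indep⟩

/-- **`¬ BoxUseful` from the exact count** (`card_blockArcSet`; the inequality is decidable for a numeric `p`). [folklore] -/
theorem not_boxUseful_of_classOKE_count [Fact p.Prime] (hp : 7 ≤ p) (cd : ClassDataE) (r : ZMod 8)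
    (hr : (p : ZMod 8) = r) (hok : cd.ClassOKE r)
    (hbig : 9 * (p * p) ≤ 5 * ∑ c, ∑ φ ∈ cd.P c,
      (bLen p φ.1 (cd.lo₁ c φ) (cd.hi₁ c φ)).toNat * (bLen p φ.2 (cd.lo₂ c φ) (cd.hi₂ c φ)).toNat) :
    ¬ BoxUseful (EisCyc p) := by
  haveI : NeZero p := ⟨(Fact.out : p.Prime).ne_zero⟩
  obtain ⟨D, hD, indep⟩ := exists_indep_of_classOKE hp cd r hr hok
  refine D.not_boxUseful_of_pattern Eis.w hD indep ?_
  obtain ⟨-, -, -, -, hP, -, -⟩ := hok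
  have hP' : ∀ c, ∀ φ ∈ cd.P c, (0 ≤ φ.1 ∧ φ.1 < 8) ∧ (0 ≤ φ.2 ∧ φ.2 < 8) := fun c φ hφ => (hP c φ hφ).1
  have hl₁ : ∀ c, ∀ φ ∈ cd.P c, 0 ≤ cd.Lo₁ c φ := fun c φ _ => Nat.cast_nonneg _
  have hh₁ : ∀ c, ∀ φ ∈ cd.P c, 0 ≤ cd.Hi₁ c φ := fun c φ _ => Nat.cast_nonneg _
  have hl₂ : ∀ c, ∀ φ ∈ cd.P c, 0 ≤ cd.Lo₂ c φ := fun c φ _ => Nat.cast_nonneg _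
  have hh₂ : ∀ c, ∀ φ ∈ cd.P c, 0 ≤ cd.Hi₂ c φ := fun c φ _ => Nat.cast_nonneg _
  rw [Eis.card, ClassDataE.arcs, card_blockArcSet hP' hl₁ hh₁ hl₂ hh₂]
  exact hbig

/-- **`¬ BoxUseful` from the uniform count bound** `576 p² ≤ 5 (p − 7)(MIS (p − 7) − Σt)` (`p ≥ 40`). [folklore] -/
theorem not_boxUseful_of_classOKE [Fact p.Prime] (hp : 40 ≤ p) (cd : ClassDataE) (r : ZMod 8) (hr : (p : ZMod 8) = r)
    (hok : cd.ClassOKE r)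
    (hcount : 576 * (p : ℤ) ^ 2 ≤ 5 * ((p : ℤ) - 7) * (cd.MIS * ((p : ℤ) - 7) - cd.SigT)) :
    ¬ BoxUseful (EisCyc p) := by
  haveI : NeZero p := ⟨(Fact.out : p.Prime).ne_zero⟩
  refine not_boxUseful_of_classOKE_count (by omega) cd r hr hok ?_
  obtain ⟨m, n, t, P, lo₁, hi₁, lo₂, hi₂⟩ := cd
  obtain ⟨-, -, -, -, hP, -, -⟩ := hok
  dsimp only at hP hcount ⊢
  -- per block: 64·N₁N₂ ≥ (p-7)(p - 7 - L₁ - L₂)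
  have hblock : ∀ c, ∀ φ ∈ P c, ((p : ℤ) - 7) * ((p : ℤ) - 7 - (lo₁ c φ + hi₁ c φ + lo₂ c φ + hi₂ c φ : ℕ)) ≤
      64 * (((bLen p φ.1 (lo₁ c φ : ℤ) (hi₁ c φ : ℤ)).toNat * (bLen p φ.2 (lo₂ c φ : ℤ) (hi₂ c φ : ℤ)).toNat : ℕ) : ℤ) := by
    intro c φ hφ
    obtain ⟨-, hL1, hL2⟩ := hP c φ hφ
    have e1 := eight_mul_bLen_ge (p := p) φ.1 (lo₁ c φ : ℤ) (hi₁ c φ : ℤ)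
    have e2 := eight_mul_bLen_ge (p := p) φ.2 (lo₂ c φ : ℤ) (hi₂ c φ : ℤ)
    set N₁ := (bLen p φ.1 (lo₁ c φ : ℤ) (hi₁ c φ : ℤ)).toNat with hN₁
    set N₂ := (bLen p φ.2 (lo₂ c φ : ℤ) (hi₂ c φ : ℤ)).toNat with hN₂
    have t1 : bLen p φ.1 (lo₁ c φ : ℤ) (hi₁ c φ : ℤ) ≤ (N₁ : ℤ) := Int.self_le_toNat _
    have t2 : bLen p φ.2 (lo₂ c φ : ℤ) (hi₂ c φ : ℤ) ≤ (N₂ : ℤ) := Int.self_le_toNat _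
    have f1 : (p : ℤ) - 7 - (lo₁ c φ + hi₁ c φ : ℕ) ≤ 8 * (N₁ : ℤ) := by push_cast; linarith
    have f2 : (p : ℤ) - 7 - (lo₂ c φ + hi₂ c φ : ℕ) ≤ 8 * (N₂ : ℤ) := by push_cast; linarith
    have g1 : 0 ≤ (p : ℤ) - 7 - (lo₁ c φ + hi₁ c φ : ℕ) := by push_cast; omega
    have g2 : 0 ≤ (p : ℤ) - 7 - (lo₂ c φ + hi₂ c φ : ℕ) := by push_cast; omega
    have prod := mul_le_mul f1 f2 g2 (by positivity)
    push_cast at prod g1 g2 ⊢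
    nlinarith [prod, g1, g2]
  -- sum over blocks
  have hsum : ((p : ℤ) - 7) * (((ClassDataE.MIS ⟨m, n, t, P, lo₁, hi₁, lo₂, hi₂⟩ : ℕ) : ℤ) * ((p : ℤ) - 7)
      - ((ClassDataE.SigT ⟨m, n, t, P, lo₁, hi₁, lo₂, hi₂⟩ : ℕ) : ℤ)) ≤
      64 * ((∑ c, ∑ φ ∈ P c, (bLen p φ.1 (lo₁ c φ : ℤ) (hi₁ c φ : ℤ)).toNat * (bLen p φ.2 (lo₂ c φ : ℤ) (hi₂ c φ : ℤ)).toNat : ℕ) : ℤ) := by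
    simp only [ClassDataE.MIS, ClassDataE.SigT]
    push_cast
    rw [Finset.sum_mul, ← Finset.sum_sub_distrib, Finset.mul_sum, Finset.mul_sum]
    refine Finset.sum_le_sum fun c _ => ?_
    have hconst : (#(P c) : ℤ) * ((p : ℤ) - 7) = ∑ φ ∈ P c, ((p : ℤ) - 7) := by
      rw [Finset.sum_const, nsmul_eq_mul]
    rw [hconst, ← Finset.sum_sub_distrib, Finset.mul_sum, Finset.mul_sum]
    refine Finset.sum_le_sum fun φ hφ => ?_
    have hb := hblock c φ hφ
    push_cast at hb ⊢
    linarith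
  have hfin : 9 * ((p : ℤ) * p) ≤ 5 * ((∑ c, ∑ φ ∈ P c,
      (bLen p φ.1 (lo₁ c φ : ℤ) (hi₁ c φ : ℤ)).toNat * (bLen p φ.2 (lo₂ c φ : ℤ) (hi₂ c φ : ℤ)).toNat : ℕ) : ℤ) := by
    nlinarith [hsum, hcount]
  exact_mod_cast hfin

end EisArcs

end Summit.MatrixMultiplication.OmegaCensus
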